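import Summits.QuantumFields.YangMills.Theorems.BalabanUVNodesN16Step04TorusBridge
import HarnessLib

/-!
# YM-DAG node N16 (NE3), the located averaging pin (42) ↔ (0.4) — part 26: THE PIN AT THE LEVEL OF BOND VARIABLES — in a local exponential gauge the (0.4)-shaped
# coarse bond variable `exp(X₀.₄)·V(q+s; seg)` IS the coarse gauge transform `e^{Λ(q)}·V̄₄₂(q,κ)·e^{−Λ(q+Le_κ)}` of Bałaban's (42) UP TO SECOND ORDER; through part 25 the
# same holds for the (0.4) average OF RECORD

Cell `pub-ymgap`, width seat `pub-ymgap-dag-n16-w3` (director-ym №197 ∕ HUMAN RULING D-0149), generation 8; part 26 of the W1b lineage (part 13 p614236 — the linear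
defect is the EXACT coarse gradient `Λ(q) − Λ(q+Le_κ)` minus the base segments, abelian: exact coarse gauge `expUnit_T04_eq_coarseGauge_bavg`; part 22 p630593 — the
exponents differ by that gradient up to `ρ₂(ℓ_s,a) + ρ₂(ℓ,a)`; part 25 p636850 — the exponent of record IS part 22's (0.4)-shaped exponent).
`--kind proof --supports stmt-QuantumFields-27366 --as helper` (K3⁸; count-neutral; 0 `def`).  `bears_on: R4∕N16`.

THE POINT.  Parts 13∕22∕25 state the pin for EXPONENTS.  A consumer of block averages reads BOND VARIABLES `V̄(c) ∈ G`.  This file integrates the exponent statement once: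
 * §1 FIRST-ORDER EXPANSION DATA compose (b07's `norm_mul_sub_one_sub_le`, `mul_sub_one_norm_le`, `expRem_add`): `expansion_mul`; the data of an exponential
   (`norm_exp_sub_one_le_of_norm_le`) and of a straight transporter in a local exponential gauge (b07's `walk_linear`).
 * §2 ★★★ `norm_expX04_mul_seg_sub_coarseGauge_bavg_le` (B7 fold, any complete normed `ℂ`-algebra `𝔸`, any `d`, any offset `s`): with `V_b = e^{A_b}`, `‖A_b‖ ≤ a` near the
   block (part 22's hypotheses),
   `‖exp(X₀.₄)·V(q+s; seg κ L) − e^{Λ(q)}·(bavg L V q κ)·e^{−Λ(q+Le_κ)}‖ ≤ [ρ₂(ℓ_s,a) + ρ₂(ℓ,a)] + expRem(‖X₀.₄‖ + La) + expRem(‖Λ(q)‖ + ‖X₄₂‖ + La + ‖Λ(q+Le_κ)‖)`,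
   `X₀.₄` = part 22's displayed (0.4)-shaped exponent at base `q+s`, `Λ` = part 13's displayed site function, `X₄₂ = Xavg L V q κ`: the first-order parts of the two
   products differ by EXACTLY part 22's quantity; every term on the right is second order (all four norms are first order in `a`).
 * §3 ★★ `norm_avOfRecord_avg_sub_coarseGauge_bavg_le` (`d = 4`, `𝔸 = M_N(ℂ)`, `s = h·𝟙`): on the (0.4) guard, THE AVERAGE OF RECORD `↑((avOfRecord F N t k).avg V c)` is within
   the same second-order bound of `e^{Λ(q_c)}·bavg F.L V̂ q_c c.dir·e^{−Λ(q_c + Le)}`, `V̂ = liftCfgOfRecord₁₁ F N t k V`, `q_c = section(emb c₋) − s` (part 25's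
   `coe_avOfRecord_avg_eq_exp_corner` + `sum_idx_eq_symSum`).  This is the (42) ↔ (0.4) pin as a statement about Bałaban's objects: per step and per block the
   averaging OF RECORD is a coarse gauge transform of (42) up to gauge-INVARIANT second order (numerically `≈ 0.1·ε³` on plaquette traces, `W3-PIN-ANATOMY-v6∕v7`).
HONEST FRAMING.  [folklore] normed-algebra bookkeeping BY NAME over b07 (`walk_linear`, `norm_mul_sub_one_sub_le`, `expRem_add`) and parts 22∕25; 0 `def`, 0 `sorry`; the
local exponential representation and the guard are DISPLAYED hypotheses; nothing about minimisers; nothing of [Balaban1985Averaging] ∕ [Balaban1987RG1] asserted beyond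
what the tree proves; K3⁸∕K3⁷ stubs NOT touched; N16 ∕ NE3 NOT discharged; count-neutral (typed 28∕28 · discharged 5∕28 — unmoved).  One finite four-torus programme
at fixed `ε` — the Yang–Mills mass gap (Clay) is NOT proved by any of this; R4 closes the conditional finite-𝕋⁴ rung `BalabanLadder.UV` only; nothing continuum ∕ ℝ⁴ ∕ OS.
-/

set_option autoImplicit false

open scoped BigOperators Matrix Matrix.Norms.L2Operator
open NormedSpace

namespace Summit.QuantumFields.YangMills.BalabanUVNodes.N16Eq04BondLevelGauge

open Literature.MathematicalPhysics.QuantumFieldTheory.Balaban1983to89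
open B7Prop1Explicit (Site Letter hol seg revWord e l1 asum treeWord boxVec Xavg bavg expUnit val_expUnit expRem expRem_add expRem_mono expRem_nonneg
  norm_mul_sub_one_sub_le norm_exp_sub_one_le_of_norm_le walk_linear length_seg exp_mul_exp_sub_one)
open B12ContourAverage253 (permWord)
open Literature.MathematicalPhysics.QuantumFieldTheory.Balaban1983to89.T4Continuum (T4Family loopWord)
open BlockAveraging (Idx off Small)
open ExpMeanLog (expMeanLogSU)
open Node00 (MatA SU cfgOfRecord avOfRecord liftCfgOfRecord₁₁)
open Summit.QuantumFields.YangMills.BalabanUVNodes.N16Eq04SameBlocksNonAbelian (norm_X04avg_sub_Xavg_sub_coarseGrad_le)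
open Summit.QuantumFields.YangMills.BalabanUVNodes.N16Step04TorusBridge (coe_avOfRecord_avg_eq_exp_corner sum_idx_eq_symSum)

noncomputable section

/-! ## §1 First-order expansion data and their composition -/

section Expansion

variable {𝔸 : Type*} [NormedRing 𝔸] [NormOneClass 𝔸] [NormedAlgebra ℂ 𝔸] [CompleteSpace 𝔸]

omit [NormOneClass 𝔸] [NormedAlgebra ℂ 𝔸] [CompleteSpace 𝔸] in
/-- **COMPOSITION OF FIRST-ORDER EXPANSION DATA**: if `‖g − 1‖ ≤ e^α − 1`, `‖g − 1 − A‖ ≤ ρ(α)` and `‖h − 1‖ ≤ e^β − 1`, `‖h − 1 − B‖ ≤ ρ(β)` (`α, β ≥ 0`), then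
`‖gh − 1‖ ≤ e^{α+β} − 1` and `‖gh − 1 − (A + B)‖ ≤ ρ(α+β)` (b07's `norm_mul_sub_one_sub_le`, `mul_sub_one_norm_le`, `expRem_add`; the step of `walk_linear`). [folklore] -/
theorem expansion_mul {g h A B : 𝔸} {α β : ℝ} (hα : 0 ≤ α) (hβ : 0 ≤ β)
    (hg : ‖g - 1‖ ≤ Real.exp α - 1 ∧ ‖g - 1 - A‖ ≤ expRem α) (hh : ‖h - 1‖ ≤ Real.exp β - 1 ∧ ‖h - 1 - B‖ ≤ expRem β) :
    ‖g * h - 1‖ ≤ Real.exp (α + β) - 1 ∧ ‖g * h - 1 - (A + B)‖ ≤ expRem (α + β) := by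
  have h1 : 0 ≤ Real.exp α - 1 := by have := Real.one_le_exp hα; linarith
  have h2 : 0 ≤ Real.exp β - 1 := by have := Real.one_le_exp hβ; linarith
  refine ⟨?_, ?_⟩
  · refine (B7Prop6Bound.mul_sub_one_norm_le _ _).trans ?_
    rw [← exp_mul_exp_sub_one]
    gcongr
    · exact hg.1
    · exact hh.1
  · refine (norm_mul_sub_one_sub_le _ _ _ _).trans ?_
    rw [expRem_add]
    gcongr
    · exact hg.1
    · exact hh.1
    · exact hg.2
    · exact hh.2

omit [NormOneClass 𝔸] in
/-- Expansion data of an exponential: `‖e^X − 1‖ ≤ e^{‖X‖} − 1`, `‖e^X − 1 − X‖ ≤ ρ(‖X‖)`. [folklore] -/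
theorem expansion_exp (X : 𝔸) : ‖exp X - 1‖ ≤ Real.exp ‖X‖ - 1 ∧ ‖exp X - 1 - X‖ ≤ expRem ‖X‖ :=
  norm_exp_sub_one_le_of_norm_le le_rfl

omit [NormOneClass 𝔸] in
/-- Expansion data of `e^{−X}` with the linear part `−X`, in the letter `‖X‖`. [folklore] -/
theorem expansion_exp_neg (X : 𝔸) : ‖exp (-X) - 1‖ ≤ Real.exp ‖X‖ - 1 ∧ ‖exp (-X) - 1 - (-X)‖ ≤ expRem ‖X‖ := by
  have h := expansion_exp (-X)
  rwa [norm_neg] at h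

variable {d : ℕ}

omit [NormOneClass 𝔸] in
/-- Expansion data of a STRAIGHT TRANSPORTER `V(p; seg κ L)` in a local exponential gauge `V_b = e^{A_b}`, `‖A_b‖ ≤ a` within `|·|₁`-distance `R ≥ L` of `p`: linear part
`A_p(seg κ L)`, letter `La` (b07's `walk_linear`). [cite: Balaban1985Averaging, p.25 (displays before (47))] -/
theorem expansion_hol_seg (V : Site d → Fin d → 𝔸ˣ) (A : Site d → Fin d → 𝔸) (p : Site d) (κ : Fin d) (L R : ℕ) (hLR : L ≤ R) {a : ℝ} (ha : 0 ≤ a)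
    (hVA : ∀ (x : Site d) (μ : Fin d), l1 (x - p) ≤ R → ((V x μ : 𝔸ˣ) : 𝔸) = exp (A x μ) ∧ ‖A x μ‖ ≤ a) :
    ‖((hol V p (seg κ (L : ℤ)) : 𝔸ˣ) : 𝔸) - 1‖ ≤ Real.exp (L * a) - 1 ∧ ‖((hol V p (seg κ (L : ℤ)) : 𝔸ˣ) : 𝔸) - 1 - asum A p (seg κ (L : ℤ))‖ ≤ expRem (L * a) := by
  have h := walk_linear V A p R ha hVA (seg κ (L : ℤ)) p (by rw [sub_self, length_seg, Int.natAbs_natCast]; simp [l1, hLR])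
  rwa [length_seg, Int.natAbs_natCast] at h

end Expansion

/-! ## §2 The pin at the level of bond variables on the B7 fold -/

section Fold

variable {d : ℕ}
variable {𝔸 : Type*} [NormedRing 𝔸] [NormOneClass 𝔸] [NormedAlgebra ℂ 𝔸] [CompleteSpace 𝔸]

omit [NormOneClass 𝔸] in
/-- **★★★ THE (0.4)-SHAPED COARSE BOND VARIABLE IS A COARSE GAUGE TRANSFORM OF (42) UP TO SECOND ORDER.**  For `V_b = e^{A_b}`, `‖A_b‖ ≤ a` within `ℓ_s = 2(dL+|s|₁)+2L` of the
base point `q+s` and within `ℓ = 2dL+2L` of the corner `q` (`e^{ℓ_s a} − 1 ≤ ½`, `e^{ℓa} − 1 ≤ ½`, `1 ≤ L`):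
`‖exp(X₀.₄)·V(q+s; seg κ L) − e^{Λ(q)}·V̄₄₂(q,κ)·e^{−Λ(q+Le_κ)}‖ ≤ [ρ₂(ℓ_s,a) + ρ₂(ℓ,a)] + ρ(‖X₀.₄‖ + La) + ρ(‖Λ(q)‖ + ‖X₄₂‖ + La + ‖Λ(q+Le_κ)‖)` — `X₀.₄` part 22's displayed
(0.4)-shaped exponent, `Λ` part 13's displayed site function, `X₄₂ = Xavg L V q κ`, `V̄₄₂ = bavg L V q κ`, `ρ = expRem`.  The first-order parts of the two products differ
by EXACTLY part 22's quantity (bounded there by `ρ₂ + ρ₂`); the two `ρ`'s are the second-order remainders of the products. [folklore] -/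
theorem norm_expX04_mul_seg_sub_coarseGauge_bavg_le (L : ℕ) (hL : 1 ≤ L) (V : Site d → Fin d → 𝔸ˣ) (A : Site d → Fin d → 𝔸) (q s : Site d) (κ : Fin d)
    {a : ℝ} (ha : 0 ≤ a)
    (hVAs : ∀ (x : Site d) (μ : Fin d), l1 (x - (q + s)) ≤ 2 * (d * L + l1 s) + L + L → ((V x μ : 𝔸ˣ) : 𝔸) = exp (A x μ) ∧ ‖A x μ‖ ≤ a)
    (hVA : ∀ (x : Site d) (μ : Fin d), l1 (x - q) ≤ 2 * (d * L) + L + L → ((V x μ : 𝔸ˣ) : 𝔸) = exp (A x μ) ∧ ‖A x μ‖ ≤ a)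
    (hsmalls : Real.exp (((2 * (d * L + l1 s) + L + L : ℕ) : ℝ) * a) - 1 ≤ 1 / 2)
    (hsmall : Real.exp (((2 * (d * L) + L + L : ℕ) : ℝ) * a) - 1 ≤ 1 / 2) :
    ‖exp (∑ r : Fin d → Fin L, (((L : ℝ) ^ d)⁻¹) • ((((Fintype.card (Equiv.Perm (Fin d)) : ℝ) ^ 2)⁻¹) •
          ∑ σ : Equiv.Perm (Fin d), ∑ σ' : Equiv.Perm (Fin d),
            MatrixLog.mlog ((hol V (q + s) (permWord σ (boxVec L r - s) ++ seg κ L ++ revWord (permWord σ' (boxVec L r - s)) ++ seg κ (-(L : ℤ))) : 𝔸ˣ) : 𝔸)))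
        * ((hol V (q + s) (seg κ (L : ℤ)) : 𝔸ˣ) : 𝔸)
      - exp (∑ r : Fin d → Fin L, (((L : ℝ) ^ d)⁻¹) • ((((Fintype.card (Equiv.Perm (Fin d)) : ℝ))⁻¹) •
            ∑ σ : Equiv.Perm (Fin d), (asum A (q + s) (permWord σ (boxVec L r - s)) - asum A q (treeWord (boxVec L r)))))
        * ((bavg L V q κ : 𝔸ˣ) : 𝔸)
        * exp (-(∑ r : Fin d → Fin L, (((L : ℝ) ^ d)⁻¹) • ((((Fintype.card (Equiv.Perm (Fin d)) : ℝ))⁻¹) •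
            ∑ σ : Equiv.Perm (Fin d), (asum A (q + (L : ℤ) • e κ + s) (permWord σ (boxVec L r - s))
              - asum A (q + (L : ℤ) • e κ) (treeWord (boxVec L r))))))‖
      ≤ ((expRem (2 * (Real.exp (((2 * (d * L + l1 s) + L + L : ℕ) : ℝ) * a) - 1)) + expRem (((2 * (d * L + l1 s) + L + L : ℕ) : ℝ) * a))
          + (expRem (2 * (Real.exp (((2 * (d * L) + L + L : ℕ) : ℝ) * a) - 1)) + expRem (((2 * (d * L) + L + L : ℕ) : ℝ) * a)))
        + expRem (‖∑ r : Fin d → Fin L, (((L : ℝ) ^ d)⁻¹) • ((((Fintype.card (Equiv.Perm (Fin d)) : ℝ) ^ 2)⁻¹) •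
              ∑ σ : Equiv.Perm (Fin d), ∑ σ' : Equiv.Perm (Fin d),
                MatrixLog.mlog ((hol V (q + s) (permWord σ (boxVec L r - s) ++ seg κ L ++ revWord (permWord σ' (boxVec L r - s)) ++ seg κ (-(L : ℤ))) : 𝔸ˣ) : 𝔸))‖
            + L * a)
        + expRem (‖∑ r : Fin d → Fin L, (((L : ℝ) ^ d)⁻¹) • ((((Fintype.card (Equiv.Perm (Fin d)) : ℝ))⁻¹) •
              ∑ σ : Equiv.Perm (Fin d), (asum A (q + s) (permWord σ (boxVec L r - s)) - asum A q (treeWord (boxVec L r))))‖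
            + ‖Xavg L V q κ‖ + L * a
            + ‖∑ r : Fin d → Fin L, (((L : ℝ) ^ d)⁻¹) • ((((Fintype.card (Equiv.Perm (Fin d)) : ℝ))⁻¹) •
              ∑ σ : Equiv.Perm (Fin d), (asum A (q + (L : ℤ) • e κ + s) (permWord σ (boxVec L r - s))
                - asum A (q + (L : ℤ) • e κ) (treeWord (boxVec L r))))‖) := by
  -- names for the players
  set X04 : 𝔸 := ∑ r : Fin d → Fin L, (((L : ℝ) ^ d)⁻¹) • ((((Fintype.card (Equiv.Perm (Fin d)) : ℝ) ^ 2)⁻¹) •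
      ∑ σ : Equiv.Perm (Fin d), ∑ σ' : Equiv.Perm (Fin d),
        MatrixLog.mlog ((hol V (q + s) (permWord σ (boxVec L r - s) ++ seg κ L ++ revWord (permWord σ' (boxVec L r - s)) ++ seg κ (-(L : ℤ))) : 𝔸ˣ) : 𝔸))
    with hX04
  set Λ1 : 𝔸 := ∑ r : Fin d → Fin L, (((L : ℝ) ^ d)⁻¹) • ((((Fintype.card (Equiv.Perm (Fin d)) : ℝ))⁻¹) •
      ∑ σ : Equiv.Perm (Fin d), (asum A (q + s) (permWord σ (boxVec L r - s)) - asum A q (treeWord (boxVec L r)))) with hΛ1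
  set Λ2 : 𝔸 := ∑ r : Fin d → Fin L, (((L : ℝ) ^ d)⁻¹) • ((((Fintype.card (Equiv.Perm (Fin d)) : ℝ))⁻¹) •
      ∑ σ : Equiv.Perm (Fin d), (asum A (q + (L : ℤ) • e κ + s) (permWord σ (boxVec L r - s)) - asum A (q + (L : ℤ) • e κ) (treeWord (boxVec L r))))
    with hΛ2
  set X42 : 𝔸 := Xavg L V q κ with hX42
  set Tc : 𝔸 := ((hol V (q + s) (seg κ (L : ℤ)) : 𝔸ˣ) : 𝔸) with hTc
  set Tq : 𝔸 := ((hol V q (seg κ (L : ℤ)) : 𝔸ˣ) : 𝔸) with hTq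
  set Sc : 𝔸 := asum A (q + s) (seg κ (L : ℤ)) with hSc
  set Sq : 𝔸 := asum A q (seg κ (L : ℤ)) with hSq
  -- part 22: the first-order parts differ by a second-order quantity
  have hR : ‖X04 - X42 - ((Λ1 - Λ2) - (Sc - Sq))‖ ≤
      (expRem (2 * (Real.exp (((2 * (d * L + l1 s) + L + L : ℕ) : ℝ) * a) - 1)) + expRem (((2 * (d * L + l1 s) + L + L : ℕ) : ℝ) * a))
        + (expRem (2 * (Real.exp (((2 * (d * L) + L + L : ℕ) : ℝ) * a) - 1)) + expRem (((2 * (d * L) + L + L : ℕ) : ℝ) * a)) :=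
    norm_X04avg_sub_Xavg_sub_coarseGrad_le L hL V A q s κ ha hVAs hVA hsmalls hsmall
  -- expansion data of the six factors
  have hLa : 0 ≤ (L : ℝ) * a := by positivity
  have hls : L ≤ 2 * (d * L + l1 s) + L + L := by omega
  have hl : L ≤ 2 * (d * L) + L + L := by omega
  have eTc := expansion_hol_seg V A (q + s) κ L _ hls ha hVAs
  have eTq := expansion_hol_seg V A q κ L _ hl ha hVA
  have eX04 := expansion_exp X04
  have eΛ1 := expansion_exp Λ1
  have eX42 := expansion_exp X42
  have eΛ2 := expansion_exp_neg Λ2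
  -- the two products
  have eLHS := expansion_mul (norm_nonneg X04) hLa eX04 eTc
  have eRHS := expansion_mul (by positivity) (norm_nonneg Λ2)
    (expansion_mul (by positivity) hLa (expansion_mul (norm_nonneg Λ1) (norm_nonneg X42) eΛ1 eX42) eTq) eΛ2
  -- (42)'s coarse bond variable is `exp(X₄₂)·V(q; seg κ L)`
  have hbavg : ((bavg L V q κ : 𝔸ˣ) : 𝔸) = exp X42 * Tq := by
    rw [hX42, hTq, bavg, Units.val_mul, val_expUnit]
  rw [hbavg, show exp Λ1 * (exp X42 * Tq) * exp (-Λ2) = exp Λ1 * exp X42 * Tq * exp (-Λ2) by simp only [mul_assoc]]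
  -- the algebra: LHS − RHS = (LHS − 1 − lin) − (RHS − 1 − lin′) + (lin − lin′), and `lin − lin′` is part 22's quantity
  have halg : exp X04 * Tc - exp Λ1 * exp X42 * Tq * exp (-Λ2) =
      (exp X04 * Tc - 1 - (X04 + Sc)) - (exp Λ1 * exp X42 * Tq * exp (-Λ2) - 1 - (Λ1 + X42 + Sq + -Λ2)) + (X04 - X42 - ((Λ1 - Λ2) - (Sc - Sq))) := by
    abel
  rw [halg]
  calc _ ≤ ‖exp X04 * Tc - 1 - (X04 + Sc)‖ + ‖exp Λ1 * exp X42 * Tq * exp (-Λ2) - 1 - (Λ1 + X42 + Sq + -Λ2)‖ + ‖X04 - X42 - ((Λ1 - Λ2) - (Sc - Sq))‖ := by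
          refine (norm_add_le _ _).trans ?_
          gcongr
          exact norm_sub_le _ _
    _ ≤ expRem (‖X04‖ + L * a) + expRem (‖Λ1‖ + ‖X42‖ + L * a + ‖Λ2‖)
          + ((expRem (2 * (Real.exp (((2 * (d * L + l1 s) + L + L : ℕ) : ℝ) * a) - 1)) + expRem (((2 * (d * L + l1 s) + L + L : ℕ) : ℝ) * a))
            + (expRem (2 * (Real.exp (((2 * (d * L) + L + L : ℕ) : ℝ) * a) - 1)) + expRem (((2 * (d * L) + L + L : ℕ) : ℝ) * a))) :=
          add_le_add (add_le_add eLHS.2 eRHS.2) hR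
    _ = _ := by ring

end Fold

/-! ## §3 The same for the (0.4) average OF RECORD (part 25's bridge) -/

section Record

variable (F : T4Family) (N : ℕ) [NeZero N]

/-- **★★ THE AVERAGE OF RECORD IS A COARSE GAUGE TRANSFORM OF (42) UP TO SECOND ORDER, AT THE LEVEL OF BOND VARIABLES.**  For a torus field `V` of the record with the (0.4)
guard at the coarse bond `c`, its lift `V̂ = liftCfgOfRecord₁₁ F N t k V` written near the block (corner `q_c = section(emb c₋) − s`, `s = h·𝟙`, `h = (L−1)∕2`) as
`V̂_b = e^{A_b}`, `‖A_b‖ ≤ a` (part 22's hypotheses at `d = 4`): `‖↑((avOfRecord F N t k).avg V c) − e^{Λ(q_c)}·bavg L V̂ q_c c.dir·e^{−Λ(q_c + Le)}‖ ≤` the second-order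
bound of §2, with the exponent OF RECORD (the `Idx`-mean of `log V̂(loop_i)`, part 25) in place of `X₀.₄`. [folklore] -/
theorem norm_avOfRecord_avg_sub_coarseGauge_bavg_le (t k : ℕ) (V : cfgOfRecord F N t k) (c : PBond (F.P t) (k + 1)) (hsm : Small expMeanLogSU V c)
    (hL : 1 ≤ F.L) (A : (Fin 4 → ℤ) → Fin 4 → MatA N) {a : ℝ} (ha : 0 ≤ a)
    (hVAs : ∀ (x : Fin 4 → ℤ) (μ : Fin 4),
      l1 (x - (((fun μ : Fin 4 => ((emb c.src μ).val : ℤ)) - fun _ : Fin 4 => (((F.L - 1) / 2 : ℕ) : ℤ)) + fun _ : Fin 4 => (((F.L - 1) / 2 : ℕ) : ℤ))) ≤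
        2 * (4 * F.L + l1 (fun _ : Fin 4 => (((F.L - 1) / 2 : ℕ) : ℤ))) + F.L + F.L →
        ((liftCfgOfRecord₁₁ F N t k V x μ : (MatA N)ˣ) : MatA N) = exp (A x μ) ∧ ‖A x μ‖ ≤ a)
    (hVA : ∀ (x : Fin 4 → ℤ) (μ : Fin 4),
      l1 (x - ((fun μ : Fin 4 => ((emb c.src μ).val : ℤ)) - fun _ : Fin 4 => (((F.L - 1) / 2 : ℕ) : ℤ))) ≤ 2 * (4 * F.L) + F.L + F.L →
        ((liftCfgOfRecord₁₁ F N t k V x μ : (MatA N)ˣ) : MatA N) = exp (A x μ) ∧ ‖A x μ‖ ≤ a)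
    (hsmalls : Real.exp (((2 * (4 * F.L + l1 (fun _ : Fin 4 => (((F.L - 1) / 2 : ℕ) : ℤ))) + F.L + F.L : ℕ) : ℝ) * a) - 1 ≤ 1 / 2)
    (hsmall : Real.exp (((2 * (4 * F.L) + F.L + F.L : ℕ) : ℝ) * a) - 1 ≤ 1 / 2) :
    ‖(((avOfRecord F N t k).avg V c : SU N) : MatA N)
      - exp (∑ r : Fin 4 → Fin F.L, (((F.L : ℝ) ^ 4)⁻¹) • ((((Fintype.card (Equiv.Perm (Fin 4)) : ℝ))⁻¹) •
            ∑ σ : Equiv.Perm (Fin 4), (asum A (((fun μ : Fin 4 => ((emb c.src μ).val : ℤ)) - fun _ : Fin 4 => (((F.L - 1) / 2 : ℕ) : ℤ))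
                + fun _ : Fin 4 => (((F.L - 1) / 2 : ℕ) : ℤ)) (permWord σ (boxVec F.L r - fun _ : Fin 4 => (((F.L - 1) / 2 : ℕ) : ℤ)))
              - asum A ((fun μ : Fin 4 => ((emb c.src μ).val : ℤ)) - fun _ : Fin 4 => (((F.L - 1) / 2 : ℕ) : ℤ)) (treeWord (boxVec F.L r)))))
        * ((bavg F.L (liftCfgOfRecord₁₁ F N t k V) ((fun μ : Fin 4 => ((emb c.src μ).val : ℤ)) - fun _ : Fin 4 => (((F.L - 1) / 2 : ℕ) : ℤ)) c.dir :
            (MatA N)ˣ) : MatA N)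
        * exp (-(∑ r : Fin 4 → Fin F.L, (((F.L : ℝ) ^ 4)⁻¹) • ((((Fintype.card (Equiv.Perm (Fin 4)) : ℝ))⁻¹) •
            ∑ σ : Equiv.Perm (Fin 4), (asum A (((fun μ : Fin 4 => ((emb c.src μ).val : ℤ)) - fun _ : Fin 4 => (((F.L - 1) / 2 : ℕ) : ℤ))
                + (F.L : ℤ) • (e c.dir : Fin 4 → ℤ) + fun _ : Fin 4 => (((F.L - 1) / 2 : ℕ) : ℤ)) (permWord σ (boxVec F.L r - fun _ : Fin 4 => (((F.L - 1) / 2 : ℕ) : ℤ)))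
              - asum A (((fun μ : Fin 4 => ((emb c.src μ).val : ℤ)) - fun _ : Fin 4 => (((F.L - 1) / 2 : ℕ) : ℤ)) + (F.L : ℤ) • (e c.dir : Fin 4 → ℤ))
                (treeWord (boxVec F.L r))))))‖
      ≤ ((expRem (2 * (Real.exp (((2 * (4 * F.L + l1 (fun _ : Fin 4 => (((F.L - 1) / 2 : ℕ) : ℤ))) + F.L + F.L : ℕ) : ℝ) * a) - 1))
            + expRem (((2 * (4 * F.L + l1 (fun _ : Fin 4 => (((F.L - 1) / 2 : ℕ) : ℤ))) + F.L + F.L : ℕ) : ℝ) * a))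
          + (expRem (2 * (Real.exp (((2 * (4 * F.L) + F.L + F.L : ℕ) : ℝ) * a) - 1)) + expRem (((2 * (4 * F.L) + F.L + F.L : ℕ) : ℝ) * a)))
        + expRem (‖∑ i : Idx (F.P t), ((Fintype.card (Idx (F.P t)) : ℝ))⁻¹ •
              MatrixLog.mlog ((hol (liftCfgOfRecord₁₁ F N t k V)
                (((fun μ : Fin 4 => ((emb c.src μ).val : ℤ)) - fun _ : Fin 4 => (((F.L - 1) / 2 : ℕ) : ℤ)) + fun _ : Fin 4 => (((F.L - 1) / 2 : ℕ) : ℤ))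
                (loopWord (F.P t).L c.dir (off i.1) i.2.1 i.2.2) : (MatA N)ˣ) : MatA N)‖ + F.L * a)
        + expRem (‖∑ r : Fin 4 → Fin F.L, (((F.L : ℝ) ^ 4)⁻¹) • ((((Fintype.card (Equiv.Perm (Fin 4)) : ℝ))⁻¹) •
              ∑ σ : Equiv.Perm (Fin 4), (asum A (((fun μ : Fin 4 => ((emb c.src μ).val : ℤ)) - fun _ : Fin 4 => (((F.L - 1) / 2 : ℕ) : ℤ))
                  + fun _ : Fin 4 => (((F.L - 1) / 2 : ℕ) : ℤ)) (permWord σ (boxVec F.L r - fun _ : Fin 4 => (((F.L - 1) / 2 : ℕ) : ℤ)))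
                - asum A ((fun μ : Fin 4 => ((emb c.src μ).val : ℤ)) - fun _ : Fin 4 => (((F.L - 1) / 2 : ℕ) : ℤ)) (treeWord (boxVec F.L r))))‖
            + ‖Xavg F.L (liftCfgOfRecord₁₁ F N t k V) ((fun μ : Fin 4 => ((emb c.src μ).val : ℤ)) - fun _ : Fin 4 => (((F.L - 1) / 2 : ℕ) : ℤ)) c.dir‖ + F.L * a
            + ‖∑ r : Fin 4 → Fin F.L, (((F.L : ℝ) ^ 4)⁻¹) • ((((Fintype.card (Equiv.Perm (Fin 4)) : ℝ))⁻¹) •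
              ∑ σ : Equiv.Perm (Fin 4), (asum A (((fun μ : Fin 4 => ((emb c.src μ).val : ℤ)) - fun _ : Fin 4 => (((F.L - 1) / 2 : ℕ) : ℤ))
                  + (F.L : ℤ) • (e c.dir : Fin 4 → ℤ) + fun _ : Fin 4 => (((F.L - 1) / 2 : ℕ) : ℤ)) (permWord σ (boxVec F.L r - fun _ : Fin 4 => (((F.L - 1) / 2 : ℕ) : ℤ)))
                - asum A (((fun μ : Fin 4 => ((emb c.src μ).val : ℤ)) - fun _ : Fin 4 => (((F.L - 1) / 2 : ℕ) : ℤ)) + (F.L : ℤ) • (e c.dir : Fin 4 → ℤ))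
                  (treeWord (boxVec F.L r))))‖) := by
  rw [coe_avOfRecord_avg_eq_exp_corner F N t k V c hsm, sum_idx_eq_symSum]
  have h := norm_expX04_mul_seg_sub_coarseGauge_bavg_le (d := 4) F.L hL (liftCfgOfRecord₁₁ F N t k V) A
    ((fun μ : Fin 4 => ((emb c.src μ).val : ℤ)) - fun _ : Fin 4 => (((F.L - 1) / 2 : ℕ) : ℤ)) (fun _ : Fin 4 => (((F.L - 1) / 2 : ℕ) : ℤ))
    c.dir ha hVAs hVA hsmalls hsmall
  exact h

end Record

end

end Summit.QuantumFields.YangMills.BalabanUVNodes.N16Eq04BondLevelGauge
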